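import Summits.BirchSwinnertonDyer.Statement
import Literature.NumberTheory.EllipticCurves.Selmer

/-!
# BirchSwinnertonDyer / SelmerRank — assembly

Route `BirchSwinnertonDyer/SelmerRank`, items `stmt-BirchSwinnertonDyer-0482` (r2) and
`stmt-BirchSwinnertonDyer-0128` (same signature): with Greenberg's corank identity
`corank Sel_{p^∞}(E/ℚ) = rank E(ℚ) + corank Ш(E/ℚ)[p^∞]` (Greenberg 1999, §1, p. 53; the named
fact `WeierstrassCurve.selmerCorank_eq_mordellWeilRank_add`) as a hypothesis, the route thesis
"for every elliptic `E/ℚ` there is a prime `p` with `corank Sel_{p^∞}(E) = r_an(E)` and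
`corank Ш(E)[p^∞] = 0`" implies the rank part of the Birch and Swinnerton-Dyer conjecture.
Pure bookkeeping: `r_an = corank Sel_{p^∞} = r_MW + 0`.
-/

namespace Literature.BSD

open WeierstrassCurve

/-- Settles `stmt-BirchSwinnertonDyer-0482` / `stmt-BirchSwinnertonDyer-0128` (assembly): the
Selmer corank identity (Greenberg 1999, §1) and the thesis of route `SelmerRank` give
`BirchSwinnertonDyer` (`= ∀ W, W.IsElliptic → W.analyticRank = W.mordellWeilRank`). [folklore] -/
theorem selmerCorank_identity_imp_thesis_imp_bsd :
    (∀ (W : WeierstrassCurve ℚ), W.selmerCorank_eq_mordellWeilRank_add) →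
      (∀ (W : WeierstrassCurve ℚ) [W.IsElliptic],
          ∃ p : ℕ, p.Prime ∧ W.selmerCorank p = W.analyticRank ∧ W.shaCorank p = 0) →
        BirchSwinnertonDyer := by
  intro hid hX W hW
  obtain ⟨p, hp, h1, h2⟩ := @hX W hW
  haveI : Fact p.Prime := ⟨hp⟩
  have h3 := @hid W hW p _
  omega

end Literature.BSD
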